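import Literature.AlgebraicGeometry.Resolution.HenselizedFunctionFieldsProofs
import Mathlib.FieldTheory.Galois.Basic
import HarnessLib

/-!
# Towers of normal extensions of degree `p`: normal steps and rebasing inside an ambient field

Topic: `Literature/AlgebraicGeometry/Resolution` (valued function fields). PROVED bookkeeping for
the towers `IsNormalPTower` / steps `IsNormalStep` of `HenselizedFunctionFields.lean` (F.-V.
Kuhlmann, *Elimination of ramification I*, Trans. AMS 362 (2010) = arXiv:1003.5678, §5, p. 19:
"a finite tower of normal extensions of degree `p`"), used by `TameTowerPGroupTowers.lean` and
`TameTowerInertiaField.lean`. All fields are subfields of one ambient field `Ω`; a finite Galois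
extension of a subfield `M ≤ Ω` is an intermediate field `L` of `Ω|M`, its subextensions are
`IntermediateField M L`, pushed into `Ω` by Mathlib's `IntermediateField.lift`.

* `IsNormalPTower.trans` — towers concatenate.
* `isNormalStep_iff`, `isNormalStep_lift` — a normal intermediate field of degree `p` is a
  normal step `IsNormalStep p`.
* Rebasing (`exists_rebase_equiv`, `exists_rebaseAutHom`, …): `L|M` finite Galois and `S` an
  intermediate field; then `L`, as an intermediate field of `Ω` over the subfield of `Ω`
  underlying `S` (`Subfield.extendScalars (lift_toSubfield_le S)`), is finite Galois
  (`isGalois_extendScalars_lift`) of degree `[L : S]` (`finrank_extendScalars_lift`), its Galois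
  group embeds into `Gal(L|M)` inside the subgroup fixing `S` (`exists_rebaseAutHom`; so it is a
  `p`-group when that subgroup is, `isPGroup_extendScalars_lift`), and intermediate fields above
  `S` rebase (`exists_rebase_intermediateField`). No new definitions: the identifications are
  packaged as existence statements, since only their consequences are used.

Everything here is standard field theory, [folklore].
-/

noncomputable section

open Module IntermediateField Polynomial

namespace Literature.AlgebraicGeometry.Resolution

universe u

variable {Ω : Type u} [Field Ω]

/-! ### Concatenation; normal steps from intermediate fields -/

/-- Towers of normal extensions of degree `p` concatenate. [folklore] -/
theorem IsNormalPTower.trans {p : ℕ} {M T T' : Subfield Ω} (h : IsNormalPTower p M T)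
    (h' : IsNormalPTower p T T') : IsNormalPTower p M T' := by
  induction h with
  | refl M => exact h'
  | step h₁ _ ih => exact IsNormalPTower.step h₁ (ih h')

/-- `(⊥ : IntermediateField M Ω)` has underlying subfield `M`. [folklore] -/
theorem bot_toSubfield (M : Subfield Ω) : (⊥ : IntermediateField M Ω).toSubfield = M := by
  ext x
  rw [IntermediateField.mem_toSubfield, IntermediateField.mem_bot]
  constructor
  · rintro ⟨c, rfl⟩
    exact c.2
  · intro hx
    exact ⟨⟨x, hx⟩, rfl⟩

/-- A normal step in terms of an intermediate field of `Ω|M`: `IsNormalStep p M K` iff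
`[K : M] = p` and `K|M` is normal. [folklore] -/
theorem isNormalStep_iff {p : ℕ} {M : Subfield Ω} (K : IntermediateField M Ω) :
    IsNormalStep p M K.toSubfield ↔ finrank M K = p ∧ Normal M K := by
  constructor
  · rintro ⟨h, hd, hn⟩
    rw [extendScalars_toSubfield_eq K h] at hd hn
    exact ⟨hd, hn⟩
  · rintro ⟨hd, hn⟩
    refine ⟨subfield_le_toSubfield K, ?_, ?_⟩
    · rw [extendScalars_toSubfield_eq K (subfield_le_toSubfield K)]
      exact hd
    · rw [extendScalars_toSubfield_eq K (subfield_le_toSubfield K)]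
      exact hn

/-- A normal intermediate field `K` of degree `p` of `L|M` gives a normal step `M ≤ K` (as
subfields of `Ω`). [folklore] -/
theorem isNormalStep_lift {p : ℕ} {M : Subfield Ω} {L : IntermediateField M Ω}
    (K : IntermediateField M L) [Normal M K] (hd : finrank M K = p) :
    IsNormalStep p M (lift K).toSubfield := by
  rw [isNormalStep_iff]
  exact ⟨by rw [← hd]; exact (liftAlgEquiv K).toLinearEquiv.finrank_eq.symm,
    Normal.of_algEquiv (liftAlgEquiv K)⟩

/-! ### Rebasing a finite Galois extension inside `Ω` to an intermediate field -/

section Rebase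

variable {M : Subfield Ω} {L : IntermediateField M Ω} (S : IntermediateField M L)

/-- `M ≤ lift S` (underlying subfields). [folklore] -/
theorem le_lift_toSubfield : M ≤ (lift S).toSubfield := subfield_le_toSubfield (lift S)

/-- `lift S ≤ L` (underlying subfields). [folklore] -/
theorem lift_toSubfield_le : (lift S).toSubfield ≤ L.toSubfield := fun _ hx => lift_le S hx

/-- Membership in the rebased top field `L`, now an intermediate field over `lift S`. [folklore] -/
theorem mem_extendScalars_lift_iff (x : Ω) :
    x ∈ Subfield.extendScalars (lift_toSubfield_le S) ↔ x ∈ L := Iff.rfl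

/-- **Rebasing equivalences**: `S ≃ (lift S : Subfield Ω)` and `L ≃ L` (the latter now an
intermediate field over `lift S`), both the identity on `Ω`, compatible with the structure maps.
[folklore] -/
theorem exists_rebase_equiv :
    ∃ (f : S ≃+* (lift S).toSubfield) (g : L ≃+* Subfield.extendScalars (lift_toSubfield_le S)),
      (algebraMap (lift S).toSubfield (Subfield.extendScalars (lift_toSubfield_le S))).comp
          (f : S →+* (lift S).toSubfield) =
        (g : L →+* Subfield.extendScalars (lift_toSubfield_le S)).comp (algebraMap S L) ∧
      (∀ x : S, ((f x : (lift S).toSubfield) : Ω) = x) ∧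
      ∀ x : L, ((g x : Subfield.extendScalars (lift_toSubfield_le S)) : Ω) = x := by
  refine ⟨{ toFun := fun x => ⟨x.1.1, (mem_lift x.1).mpr x.2⟩
            invFun := fun x => ⟨⟨x.1, lift_le S x.2⟩, (mem_lift ⟨x.1, lift_le S x.2⟩).mp x.2⟩
            left_inv := fun _ => rfl
            right_inv := fun _ => rfl
            map_mul' := fun _ _ => rfl
            map_add' := fun _ _ => rfl },
          { toFun := fun x => ⟨x.1, x.2⟩
            invFun := fun x => ⟨x.1, x.2⟩
            left_inv := fun _ => rfl
            right_inv := fun _ => rfl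
            map_mul' := fun _ _ => rfl
            map_add' := fun _ _ => rfl }, RingHom.ext fun _ => Subtype.ext rfl, fun _ => rfl, fun _ => rfl⟩

/-- `L` is finite over `lift S` if it is finite over `M`. [folklore] -/
theorem finiteDimensional_extendScalars_lift [FiniteDimensional M L] :
    FiniteDimensional (lift S).toSubfield (Subfield.extendScalars (lift_toSubfield_le S)) := by
  haveI : FiniteDimensional S L := Module.Finite.of_restrictScalars_finite M S L
  obtain ⟨f, g, h, -, -⟩ := exists_rebase_equiv S
  exact Module.Finite.of_equiv_equiv f g h

/-- `[L : lift S] = [L : S]`. [folklore] -/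
theorem finrank_extendScalars_lift :
    finrank (lift S).toSubfield (Subfield.extendScalars (lift_toSubfield_le S)) = finrank S L := by
  obtain ⟨f, g, h, -, -⟩ := exists_rebase_equiv S
  exact (Algebra.finrank_eq_of_equiv_equiv f g h).symm

/-- `L` is Galois over `lift S` if it is Galois over `M`. [folklore] -/
theorem isGalois_extendScalars_lift [FiniteDimensional M L] [IsGalois M L] :
    IsGalois (lift S).toSubfield (Subfield.extendScalars (lift_toSubfield_le S)) := by
  haveI : IsGalois S L := IsGalois.tower_top_of_isGalois M S L
  obtain ⟨f, g, h, -, -⟩ := exists_rebase_equiv S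
  exact IsGalois.of_equiv_equiv (f := f) (g := g) h

/-- **The Galois group of `L` over `lift S` embeds into `Gal(L|M)`, inside the subgroup fixing
`S`** (an automorphism over `lift S` is an automorphism over `M` fixing `S`). [folklore] -/
theorem exists_rebaseAutHom :
    ∃ φ : (Subfield.extendScalars (lift_toSubfield_le S) ≃ₐ[(lift S).toSubfield]
        Subfield.extendScalars (lift_toSubfield_le S)) →* (L ≃ₐ[M] L),
      Function.Injective φ ∧ ∀ σ, φ σ ∈ S.fixingSubgroup := by
  obtain ⟨f, g, hfg, hf, hg⟩ := exists_rebase_equiv S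
  -- `g` identifies the two structure maps out of `M`
  have hgM : ∀ c : M, g (algebraMap M L c) =
      algebraMap (lift S).toSubfield (Subfield.extendScalars (lift_toSubfield_le S))
        ⟨c, le_lift_toSubfield S c.2⟩ := fun c => Subtype.ext (by rw [hg]; rfl)
  have hgS : ∀ x : L, x ∈ S → ∃ c : (lift S).toSubfield, g x =
      algebraMap (lift S).toSubfield (Subfield.extendScalars (lift_toSubfield_le S)) c :=
    fun x hx => ⟨⟨x, (mem_lift x).mpr hx⟩, Subtype.ext (by rw [hg]; rfl)⟩
  let φ₀ : (Subfield.extendScalars (lift_toSubfield_le S) ≃ₐ[(lift S).toSubfield]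
      Subfield.extendScalars (lift_toSubfield_le S)) → (L ≃ₐ[M] L) := fun σ =>
    AlgEquiv.ofRingEquiv (f := (g.trans σ.toRingEquiv).trans g.symm) (fun c => by
      change g.symm (σ (g (algebraMap M L c))) = algebraMap M L c
      rw [hgM, AlgEquiv.commutes, ← hgM, RingEquiv.symm_apply_apply])
  have hφ₀ : ∀ σ (x : L), φ₀ σ x = g.symm (σ (g x)) := fun _ _ => rfl
  refine ⟨{ toFun := φ₀
            map_one' := AlgEquiv.ext fun x => by
              rw [hφ₀, AlgEquiv.one_apply, AlgEquiv.one_apply, RingEquiv.symm_apply_apply]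
            map_mul' := fun σ τ => AlgEquiv.ext fun x => by
              rw [AlgEquiv.mul_apply, hφ₀, hφ₀, hφ₀, AlgEquiv.mul_apply,
                RingEquiv.apply_symm_apply] }, ?_, ?_⟩
  · intro σ τ h
    apply AlgEquiv.ext
    intro y
    have h1 : φ₀ σ (g.symm y) = φ₀ τ (g.symm y) := AlgEquiv.congr_fun h (g.symm y)
    rw [hφ₀, hφ₀, RingEquiv.apply_symm_apply] at h1
    exact g.symm.injective h1
  · intro σ
    rw [IntermediateField.mem_fixingSubgroup_iff]
    intro x hx
    obtain ⟨c, hc⟩ := hgS x hx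
    change φ₀ σ x = x
    rw [hφ₀, hc, AlgEquiv.commutes, ← hc, RingEquiv.symm_apply_apply]

/-- The Galois group of `L` over `lift S` is a `p`-group if the subgroup fixing `S` is.
[folklore] -/
theorem isPGroup_extendScalars_lift {p : ℕ} (hS : IsPGroup p S.fixingSubgroup) :
    IsPGroup p (Subfield.extendScalars (lift_toSubfield_le S) ≃ₐ[(lift S).toSubfield]
      Subfield.extendScalars (lift_toSubfield_le S)) := by
  obtain ⟨φ, hinj, hmem⟩ := exists_rebaseAutHom S
  intro σ
  obtain ⟨k, hk⟩ := hS ⟨φ σ, hmem σ⟩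
  refine ⟨k, hinj ?_⟩
  rw [map_pow, map_one]
  exact congrArg Subtype.val hk

/-- An intermediate field `K ≥ S` of `L|M`, rebased: an intermediate field of `L|lift S` with the
same underlying subfield of `Ω`. [folklore] -/
theorem exists_rebase_intermediateField (K : IntermediateField M L) (hSK : S ≤ K) :
    ∃ K' : IntermediateField (lift S).toSubfield (Subfield.extendScalars (lift_toSubfield_le S)),
      (lift K').toSubfield = (lift K).toSubfield := by
  have hle : (lift S).toSubfield ≤ (lift K).toSubfield := by
    intro x hx
    exact (mem_lift ⟨x, lift_le S hx⟩).mpr (hSK ((mem_lift ⟨x, lift_le S hx⟩).mp hx))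
  have hKL : Subfield.extendScalars hle ≤ Subfield.extendScalars (lift_toSubfield_le S) := by
    intro x hx
    exact lift_le K hx
  refine ⟨IntermediateField.restrict hKL, ?_⟩
  rw [lift_restrict, Subfield.extendScalars_toSubfield]

end Rebase

end Literature.AlgebraicGeometry.Resolution
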